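import Summits.QuantumFields.YangMills.Theorems.UnitScaleTiltFluctuationComparisonRegPrGlobalSlackKernelLegDisplayProfile
import Summits.QuantumFields.YangMills.Theorems.UnitScaleTiltMinimiserStabilityRegPrAttainmentOfExistence
import HarnessLib

/-!
# `UnitScaleTiltFluctuationComparisonRegPrGlobalSlackKernelLegDisplayProfileLow` — THE TOP-HEIGHT CLAUSE OF (R4) IS `bound28` AT THE SHIFTED PROFILE; THE SIX-ROW DISPLAY WITH
# (R4) ASKED ONLY BELOW THE NEW LEVEL, AND THE DECIDING CRUX FROM 19200's TWO v10 LEAVES (crux `FluctuationComparisonRegPrIntL`, stmt-QuantumFields-20520, skeleton v5kC, STUB 3⁗χ;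
# width seat ym-ust-20520-w1 g2; count-neutral; YM₃ on the 3-torus is ladder rung R3, not the Clay problem)

WHY.  In the six-row display at a profile `p₁ ≥ p₀ + r₀` (`K1aLegRowsDisplayChiAt`, this seat, p592610) the configuration row (R4) `CfgDistOwnΦ D B dist 𝔠.b₀ p₁ C_s` asks, for every
height `n`, level `j < K − n` and listed domain, `‖B K (K−n) j Y (V↑) c‖ ≤ C_s(1 + d(c))·θ_{b₀,p₁}(n)·L^{−2(K−n−1−j)}`.  Its TOP clause `j = K − n − 1` (the NEW level, `x = 1`) is, by
(N) `NewLevelIsBirth` (`B = Bcfg` there), the displayed row (28) `bound28` VERBATIM: `‖Bcfg_X(h, W)‖ ≤ cB·r(g_k)g_kp(g_k) = cB·θ_{b₀,p₀+r₀}(K−k)` for EVERY history and field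
(`GlobalSlackCanonicalPolymers.rFun_mul_mul_pFun`) — one height up and `θ` monotone in the log-power give `≤ cB·((√L)⁻¹(1+log √L)^{p₁})·θ_{b₀,p₁}(K−k−1)`.  So at the door's
profiles only the LOWER clauses of (R4) (`j + 1 < K − n`: print's (27)/(44) for the averaged old-level configurations) are a display:

* §1 `norm_birthCfg_le_theta_at` / **`norm_birthCfg_le_theta_profile`** — the birth configuration's sup norm from `bound28`, per run, every `h`, `W`;
* §2 **`CfgDistOwnΦLow`** (hypothesis schema: (R4) with `j + 1 < K − n` only), `cfgFam_level_cast`, and **`cfgDistOwnΦ_chi_of_low_of_newLevelIsBirth`**: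
  (N) ∧ (R4-low at `p₁`) ⟹ `CfgDistOwnΦ … 𝔠.b₀ p₁ (max C_s (cB·(√L)⁻¹(1+log √L)^{p₁}))` for `p₀ + r₀ ≤ p₁`;
* §3 **`K1aLegRowsDisplayChiAtLow L 𝔠 a₀ a₁ a p₁`** (the display with (R4) ↦ (R4-low)), `k1aLegRowsDisplayChiAt_of_low`, and the crux compositions
  `regPrIntL_of_T8_recChi_k1aLegRowsDisplayChiAtLow_allL` (T8's text), **`regPrIntL_of_halving_exist_recChi_k1aLegRowsDisplayChiAt_allL`** / **`…AtLow_allL`** (19200 v10's TWO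
  registered leaves `stub_halvingStep` ∧ `stub_existenceMinimalOrbit` VERBATIM, through ★w4-20520 g0's `AttainmentOfExistence.thm1In8GlobalMin_of_halvingStep_of_existence`; OWNER RULING
  g24-№5 DEPMAP v3.6 «20520 ⇐ {H, EX, 2′χ, one K1a predicate}» with the predicate = the display at `p₁`, five displayed rows + (R4-low)).
HONEST FRAMING: bookkeeping over one displayed row and hypothesis schemas; nothing of [Balaban1985UV3]/[King1986] asserted; registry untouched (`--supports stmt-QuantumFields-20520`);
the remaining rows are DISPLAYS (NODE-O depth); no claim on the stub, the crux, d = 4 or the mass gap.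

References: T. Bałaban, CMP 102 (1985) 255–275 [Balaban1985UV3] ((7) p.257, (27)–(28) p.263, (43)–(45) pp.266–267, (57) p.270); CMP 102 (1985) 277–309 [Balaban1985Variational]
(Thm 1 (8) p.279, Prop. 7 p.299, Prop. 8 p.304); C. King, CMP 102 (1986) 649–677 [King1986] (Thm 3.4 (3.9) p.656, Prop. 3.9 (3.71)–(3.74) p.665).
-/

set_option autoImplicit false

noncomputable section

open scoped BigOperators
open Finset
open Literature.MathematicalPhysics.QuantumFieldTheory.Balaban1983to89
open Literature.MathematicalPhysics.QuantumFieldTheory.Balaban1983to89.T3ContinuumYM3Torus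
open Literature.MathematicalPhysics.QuantumFieldTheory.Balaban1983to89.T3UnitScaleTilt
open Literature.MathematicalPhysics.QuantumFieldTheory.Balaban1983to89.T3LevelShift
open Literature.MathematicalPhysics.QuantumFieldTheory.Balaban1983to89.T3AlphaInputsAC
open Literature.MathematicalPhysics.QuantumFieldTheory.Balaban1983to89.T3AlphaPolymerSocket
open Literature.MathematicalPhysics.QuantumFieldTheory.Balaban1983to89.T3AlphaInputsACTwoRun
open Literature.MathematicalPhysics.QuantumFieldTheory.Balaban1983to89.T3AlphaInputsACTwoRunLevel
open Literature.MathematicalPhysics.QuantumFieldTheory.Balaban1983to89.TreeLengthTorus (tsys)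
open Literature.MathematicalPhysics.QuantumFieldTheory.Balaban1985CMP102
open Literature.MathematicalPhysics.QuantumFieldTheory.Balaban1985CMP102.Setting
open Summit.QuantumFields.Balaban3D.Carriers
open Summit.QuantumFields.Balaban3D.Proofs.Primitives
open Summit.QuantumFields.Balaban3D.Proofs.GroupModelLieC (lieC)
open Summit.QuantumFields.Balaban3D.Proofs.ScalesArithmetic (gk_pos gk_le_one)
open Summit.QuantumFields.YangMills.Theorems
open Summit.QuantumFields.YangMills.Theorems.GlobalSlack (GlobalSupRateTSlack)
open Summit.QuantumFields.YangMills.Theorems.GlobalSlackKernelMatching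
open Summit.QuantumFields.YangMills.Theorems.GlobalSlackCanonicalPolymers

namespace Summit.QuantumFields.YangMills.Theorems.GlobalSlackKernelLeg

variable {F : T3Family} {𝔠 : AlphaConsts F.L (suGroupModel 2).N} {γ : ℝ} {hγ : 0 < γ} {hγ1 : γ ≤ (min 𝔠.gamma0 1) ^ 2}

/-! ## §1 The birth configuration's sup norm from (28), at the shifted profile -/

section Birth

variable (q : ∀ K, AlphaInputsT3AC.PkgCoreV3 F 𝔠 γ hγ hγ1 K)

/-- **(28) IN THRESHOLD CURRENCY**: for `k + 1 ≤ K`, every step-`k` domain `X`, history `h` and field `W`, `‖Bcfg_X(h, W)‖ ≤ cB·θ_{b₀,p₀+r₀}(K − k)` — the displayed row `bound28`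
(`cB·r(g_k)·g_k·p(g_k)`) with `r·g·p = g·p_{p₀+r₀}` (`rFun_mul_mul_pFun`) and `g_k = √(γL^{−(K−k)})`. [cite: Balaban1985UV3, (28) p.263, (7) p.257] -/
theorem norm_birthCfg_le_theta_at (K k : ℕ) (hk : k + 1 ≤ K) (X : (tsys 3 (nblkOf (SK F 𝔠 γ hγ hγ1 K) 𝔠.lane.carrier k)).Dom)
    (h : Hist (F.P K) (k + 1)) (W : GaugeField (F.P K) (k + 1) (Matrix.specialUnitaryGroup (Fin 2) ℂ)) :
    ‖((q K).𝔖 k).Bcfg X h W‖ ≤ 𝔠.cB * θBal F.L γ 𝔠.b₀ (𝔠.p₀ + 𝔠.r₀) (K - k) := by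
  have hg0 : 0 < (SK F 𝔠 γ hγ hγ1 K).gk k := gk_pos _ k
  have hg1 : (SK F 𝔠 γ hγ hγ1 K).gk k ≤ 1 := gk_le_one _ (SK F 𝔠 γ hγ hγ1 K).gK_le_one k (by show k ≤ K; omega)
  have hg : (SK F 𝔠 γ hγ hγ1 K).gk k = Real.sqrt (γ * ((F.L : ℝ)⁻¹) ^ (K - k)) := by rw [SK, T3Scales_gk_eq F γ hγ _ K k (by omega)]
  have hb := ((q K).runCore.steps k hk).bound28 X h W
  rw [rFun_mul_mul_pFun hg0 hg1, hg, ← T3Thresholds.θBal_eq F.L γ 𝔠.b₀ (𝔠.p₀ + 𝔠.r₀) (K - k)] at hb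
  exact hb

/-- **(28) AT ANY PROFILE `p₁ ≥ p₀ + r₀`, ONE HEIGHT UP**: `‖Bcfg_X(h, W)‖ ≤ cB·((√L)⁻¹(1 + log √L)^{p₁})·θ_{b₀,p₁}(K − k − 1)` (`GlobalSlackOn.θBal_mono_p`, `θBal_succ_le_mul`).
[cite: Balaban1985UV3, (28) p.263, (5) p.256, (7) p.257] -/
theorem norm_birthCfg_le_theta_profile {p₁ : ℝ} (hp : 𝔠.p₀ + 𝔠.r₀ ≤ p₁) (K k : ℕ) (hk : k + 1 ≤ K)
    (X : (tsys 3 (nblkOf (SK F 𝔠 γ hγ hγ1 K) 𝔠.lane.carrier k)).Dom)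
    (h : Hist (F.P K) (k + 1)) (W : GaugeField (F.P K) (k + 1) (Matrix.specialUnitaryGroup (Fin 2) ℂ)) :
    ‖((q K).𝔖 k).Bcfg X h W‖ ≤ 𝔠.cB * ((Real.sqrt F.L)⁻¹ * (1 + Real.log (Real.sqrt F.L)) ^ p₁) * θBal F.L γ 𝔠.b₀ p₁ (K - k - 1) := by
  have hL : 1 ≤ F.L := F.hL.2.le
  have hγ1' : γ ≤ 1 := hγ1.trans (sq_min_one_le _ 𝔠.gamma0_pos)
  have hp₁ : 0 ≤ p₁ := le_trans 𝔠.r₀_add_p₀_nonneg (by linarith)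
  have hmono : θBal F.L γ 𝔠.b₀ (𝔠.p₀ + 𝔠.r₀) (K - k) ≤ θBal F.L γ 𝔠.b₀ p₁ (K - k) :=
    GlobalSlackOn.θBal_mono_p hL hγ hγ1' 𝔠.b₀_pos.le hp (K - k)
  have hup : θBal F.L γ 𝔠.b₀ p₁ (K - k) ≤ (Real.sqrt F.L)⁻¹ * (1 + Real.log (Real.sqrt F.L)) ^ p₁ * θBal F.L γ 𝔠.b₀ p₁ (K - k - 1) := by
    rw [show K - k = (K - k - 1) + 1 by omega]
    exact θBal_succ_le_mul hL hγ hγ1' 𝔠.b₀_pos.le hp₁ (K - k - 1)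
  calc ‖((q K).𝔖 k).Bcfg X h W‖ ≤ 𝔠.cB * θBal F.L γ 𝔠.b₀ (𝔠.p₀ + 𝔠.r₀) (K - k) := norm_birthCfg_le_theta_at q K k hk X h W
    _ ≤ 𝔠.cB * ((Real.sqrt F.L)⁻¹ * (1 + Real.log (Real.sqrt F.L)) ^ p₁ * θBal F.L γ 𝔠.b₀ p₁ (K - k - 1)) :=
        mul_le_mul_of_nonneg_left (hmono.trans hup) 𝔠.cB_nonneg
    _ = _ := by ring

end Birth

/-! ## §2 (R4) below the new level, and the full row from it and (N) -/

section Low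

variable {𝕍 : Type} [NormedAddCommGroup 𝕍] [NormedSpace ℂ 𝕍]

/-- **THE OWN-INDEXED (44) ROW IN DISTANCE FORM, BELOW THE NEW LEVEL ONLY** (hypothesis schema, never asserted): `CfgDistOwnΦ` with its top clause `j = K − n − 1` deleted — for
`j + 1 < K − n`, on run `K`'s `θ(n)`-window and listed domains, `‖B K (K−n) j Y (V↑) c‖ ≤ C_s·(1 + d(c))·θ(n)·L^{−2(K−n−1−j)}` (print's (27)/(44) for the averaged OLD-level
configurations at which the old terms are read). [cite: Balaban1985UV3, (27)-(28) p.263, (44) p.267] -/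
def CfgDistOwnΦLow (D : AlphaDataT3 F γ) (B : CfgFam 𝕍 F) (dist : LegDist F) (b₀ p₀ C_s : ℝ) : Prop :=
  ∀ (K n : ℕ) (h : n ≤ K), ∀ j : ℕ, j + 1 < K - n →
    ∀ V : GaugeField (F.P n) 0 (Matrix.specialUnitaryGroup (Fin 2) ℂ), PlaqSmall (θBal F.L γ b₀ p₀ n) V →
      ∀ Y ∈ D.Loc K (K - n) (D.triv K (K - n)) (1 + j), ∀ c : PBond (F.P K) j,
        ‖B K (K - n) j Y (fieldShift (F.sitesPerDir_eq (m := F.m) (K := K) (j := K - n) (m' := F.m) (K' := n) (j' := 0) (by omega)) V) c‖ ≤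
          C_s * (1 + dist K j Y c) * θBal F.L γ b₀ p₀ n * (((F.L : ℝ) ^ (K - n - 1 - j))⁻¹) ^ 2

omit [NormedSpace ℂ 𝕍] in
/-- The full row gives the row below the new level (same constant). [folklore] -/
theorem cfgDistOwnΦLow_of_full {D : AlphaDataT3 F γ} {B : CfgFam 𝕍 F} {dist : LegDist F} {b₀ p₀ C_s : ℝ} (h : CfgDistOwnΦ D B dist b₀ p₀ C_s) :
    CfgDistOwnΦLow D B dist b₀ p₀ C_s :=
  fun K n hn j hj V hV Y hY c => h K n hn j (by omega) V hV Y hY c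

omit [NormedAddCommGroup 𝕍] [NormedSpace ℂ 𝕍] in
/-- A configuration family read at a shifted field depends on the lattice level only through the modulus identity. [folklore] -/
theorem cfgFam_level_cast (B : CfgFam 𝕍 F) (K : ℕ) {j₁ j₂ : ℕ} (e : j₁ = j₂) (b : ℕ) (Y : Set (Site (F.P K) 0))
    {m' K' j' : ℕ} (h₁ : (F.PP F.m K).sitesPerDir j₁ = (F.PP m' K').sitesPerDir j') (h₂ : (F.PP F.m K).sitesPerDir j₂ = (F.PP m' K').sitesPerDir j')
    (V : GaugeField (F.PP m' K') j' (Matrix.specialUnitaryGroup (Fin 2) ℂ)) :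
    B K j₁ b Y (fieldShift h₁ V) = B K j₂ b Y (fieldShift h₂ V) := by
  subst e; rfl

end Low

section Split

/-- **(R4) FROM (R4-low) AND (N), AT EVERY PROFILE `p₁ ≥ p₀ + r₀`**, at the χ-record's canonical datum: on the new level the configuration IS `Bcfg` (`NewLevelIsBirth`), whose
components are `≤ ‖Bcfg‖ ≤ cB·((√L)⁻¹(1+log √L)^{p₁})·θ_{b₀,p₁}(n)` (`norm_birthCfg_le_theta_profile`, `1 ≤ 1 + d(c)` by `canonLegDist_nonneg`); below it, the display.  Constant
`max C_s (cB·(√L)⁻¹(1+log √L)^{p₁})`. [cite: Balaban1985UV3, (27)-(28) p.263, (44) p.267] -/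
theorem cfgDistOwnΦ_chi_of_low_of_newLevelIsBirth (p : ∀ K, AlphaInputsT3AC.PkgAtV3Chi F 𝔠 γ hγ hγ1 K) {Φ : ChartFam ↥(lieC (suGroupModel 2)) F} {e : VacFam F}
    {B : CfgFam ↥(lieC (suGroupModel 2)) F} {p₁ C_s : ℝ} (hp : 𝔠.p₀ + 𝔠.r₀ ≤ p₁) (hCs : 0 ≤ C_s)
    (hN : NewLevelIsBirth (fun K => (p K).toCore) Φ e B)
    (hlow : CfgDistOwnΦLow (AlphaInputsT3AC.dataOfV3chi p (canonPolymerCore fun K => (p K).toCore)) B (canonLegDist F) 𝔠.b₀ p₁ C_s) :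
    CfgDistOwnΦ (AlphaInputsT3AC.dataOfV3chi p (canonPolymerCore fun K => (p K).toCore)) B (canonLegDist F) 𝔠.b₀ p₁
      (max C_s (𝔠.cB * ((Real.sqrt F.L)⁻¹ * (1 + Real.log (Real.sqrt F.L)) ^ p₁))) := by
  classical
  set q : ∀ K, AlphaInputsT3AC.PkgCoreV3 F 𝔠 γ hγ hγ1 K := fun K => (p K).toCore with hq
  have hL : 1 ≤ F.L := F.hL.2.le
  have hγ1' : γ ≤ 1 := hγ1.trans (sq_min_one_le _ 𝔠.gamma0_pos)
  intro K n hn j hj V hV Y hY c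
  have hθ : 0 ≤ θBal F.L γ 𝔠.b₀ p₁ n := (T3MinimiserStabilityReduction.θBal_pos hL hγ hγ1' 𝔠.b₀_pos p₁ n).le
  have hd : 0 ≤ canonLegDist F K j Y c := canonLegDist_nonneg F K j Y c
  have hx2 : 0 ≤ (((F.L : ℝ) ^ (K - n - 1 - j))⁻¹) ^ 2 := by positivity
  by_cases hjt : j + 1 < K - n
  · -- below the new level: the display, with the larger constant
    refine (hlow K n hn j hjt V hV Y hY c).trans ?_
    have h0 : 0 ≤ (1 + canonLegDist F K j Y c) * θBal F.L γ 𝔠.b₀ p₁ n * (((F.L : ℝ) ^ (K - n - 1 - j))⁻¹) ^ 2 := by positivity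
    calc C_s * (1 + canonLegDist F K j Y c) * θBal F.L γ 𝔠.b₀ p₁ n * (((F.L : ℝ) ^ (K - n - 1 - j))⁻¹) ^ 2
        = C_s * ((1 + canonLegDist F K j Y c) * θBal F.L γ 𝔠.b₀ p₁ n * (((F.L : ℝ) ^ (K - n - 1 - j))⁻¹) ^ 2) := by ring
      _ ≤ max C_s (𝔠.cB * ((Real.sqrt F.L)⁻¹ * (1 + Real.log (Real.sqrt F.L)) ^ p₁)) *
            ((1 + canonLegDist F K j Y c) * θBal F.L γ 𝔠.b₀ p₁ n * (((F.L : ℝ) ^ (K - n - 1 - j))⁻¹) ^ 2) := mul_le_mul_of_nonneg_right (le_max_left _ _) h0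
      _ = _ := by ring
  · -- the new level `j = K − n − 1`: the configuration is `Bcfg`, bounded by (28)
    have hk : K - n = j + 1 := by omega
    have hjK : j + 1 ≤ K := by omega
    rw [cfgFam_level_cast B K hk j Y _ (F.sitesPerDir_eq (m := F.m) (K := K) (j := j + 1) (m' := F.m) (K' := n) (j' := 0) (by omega)) V]
    set W := fieldShift (F.sitesPerDir_eq (m := F.m) (K := K) (j := j + 1) (m' := F.m) (K' := n) (j' := 0) (by omega)) V with hW
    change Y ∈ canonLocCore q K (K - n) (Hist.triv (F.P K) (K - n)) (1 + j) at hY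
    rw [hk, show 1 + j = j + 1 by omega] at hY
    simp only [canonLocCore, if_pos hjK, ite_true, mem_image] at hY
    obtain ⟨X, hX, rfl⟩ := hY
    obtain ⟨-, -, hB⟩ := hN K j hjK X hX
    rw [hB W]
    have hn' : K - j - 1 = n := by omega
    have hcomp := (norm_le_pi_norm (((q K).𝔖 j).Bcfg X (Hist.triv (F.P K) (j + 1)) W) c).trans (norm_birthCfg_le_theta_profile q hp K j hjK X _ W)
    rw [hn'] at hcomp
    refine hcomp.trans ?_
    have hxk : (((F.L : ℝ) ^ (K - n - 1 - j))⁻¹) ^ 2 = 1 := by rw [show K - n - 1 - j = 0 by omega]; simp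
    rw [hxk, mul_one]
    have hc0 : 0 ≤ max C_s (𝔠.cB * ((Real.sqrt F.L)⁻¹ * (1 + Real.log (Real.sqrt F.L)) ^ p₁)) := le_max_of_le_left hCs
    calc 𝔠.cB * ((Real.sqrt F.L)⁻¹ * (1 + Real.log (Real.sqrt F.L)) ^ p₁) * θBal F.L γ 𝔠.b₀ p₁ n
        ≤ max C_s (𝔠.cB * ((Real.sqrt F.L)⁻¹ * (1 + Real.log (Real.sqrt F.L)) ^ p₁)) * θBal F.L γ 𝔠.b₀ p₁ n := mul_le_mul_of_nonneg_right (le_max_right _ _) hθ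
      _ = max C_s (𝔠.cB * ((Real.sqrt F.L)⁻¹ * (1 + Real.log (Real.sqrt F.L)) ^ p₁)) * 1 * θBal F.L γ 𝔠.b₀ p₁ n := by ring
      _ ≤ max C_s (𝔠.cB * ((Real.sqrt F.L)⁻¹ * (1 + Real.log (Real.sqrt F.L)) ^ p₁)) * (1 + canonLegDist F K j (domSet (F := F) 𝔠.lane.carrier.M₁ K j X) c) *
            θBal F.L γ 𝔠.b₀ p₁ n := by
          refine mul_le_mul_of_nonneg_right (mul_le_mul_of_nonneg_left (by linarith) hc0) hθ

end Split

/-! ## §3 The display with (R4) below the new level only, and the crux from 19200's two v10 leaves -/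

/-- **3⁗χ AS ONE PER-RUN DISPLAY OBLIGATION AT THE PROFILE `p₁`, (R4) BELOW THE NEW LEVEL ONLY** (hypothesis schema, never asserted): `K1aLegRowsDisplayChiAt` (p592610) with
(R4) `CfgDistOwnΦ` replaced by (R4-low) `CfgDistOwnΦLow` — FIVE displayed rows about one run each ((R1) kernel closeness to a height-free reference, (R2′) leg-weighted analyticity,
(N) new level is birth, (M1) old terms are jets, (R5) loop-variable closeness to a coherent reference) plus (R4-low). [cite: King1986, Thm 3.4 (3.9) p.656, Prop. 3.6 (3.56) p.662, Prop. 3.9 (3.71)-(3.74) p.665; Balaban1985UV3, (25) p.262, (27)-(28) p.263, (43)-(45) pp.266-267] -/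
def K1aLegRowsDisplayChiAtLow (L : ℕ) (𝔠 : AlphaConsts L (suGroupModel 2).N) (a₀ a₁ a p₁ : ℝ) : Prop :=
  ∃ (κ' ρ C C_A C_s C_B γB : ℝ), 0 < κ' ∧ 0 < ρ ∧ 0 ≤ C ∧ 0 ≤ C_A ∧ 0 ≤ C_s ∧ 0 ≤ C_B ∧ 0 < γB ∧
    ∀ (F : T3Family) (γ : ℝ) (hF : F.L = L) (hγ : 0 < γ), γ ≤ γB → ∀ (hγ1 : γ ≤ (min (hF ▸ 𝔠).gamma0 1) ^ 2),
      ∃ (Ψ : ChartFam ↥(lieC (suGroupModel 2)) F) (BR : CfgFam ↥(lieC (suGroupModel 2)) F), KerHeightFree Ψ ∧ RefCfgCoherent BR ∧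
        (AlphaInputsT3AC.OfV3ChiAt F (hF ▸ 𝔠) a₀ a₁ →
          ∃ (p : ∀ K, AlphaInputsT3AC.PkgAtV3Chi F (hF ▸ 𝔠) γ hγ hγ1 K), (∀ K, (p K).a₀ = a₀ ∧ (p K).a₁ = a₁) ∧
            ∃ (Φ : ChartFam ↥(lieC (suGroupModel 2)) F) (e : VacFam F) (B : CfgFam ↥(lieC (suGroupModel 2)) F),
              KernelRefOwnΦ (AlphaInputsT3AC.dataOfV3chi p (canonPolymerCore fun K => (p K).toCore)) Φ Ψ (canonLegDist F) κ' (hF ▸ 𝔠).κ a C ∧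
              ChartAnalyticΦ (AlphaInputsT3AC.dataOfV3chi p (canonPolymerCore fun K => (p K).toCore)) (rescaleΦw (canonLegDist F) κ' Φ) (hF ▸ 𝔠).κ ρ C_A ∧
              NewLevelIsBirth (fun K => (p K).toCore) Φ e B ∧
              OldTermsAreJetsOwn (fun K => (p K).toCore) Φ e B ∧
              CfgDistOwnΦLow (AlphaInputsT3AC.dataOfV3chi p (canonPolymerCore fun K => (p K).toCore)) B (canonLegDist F) (hF ▸ 𝔠).b₀ p₁ C_s ∧
              CfgRefOwnΦ (AlphaInputsT3AC.dataOfV3chi p (canonPolymerCore fun K => (p K).toCore)) B BR (canonLegDist F) (hF ▸ 𝔠).b₀ p₁ a C_B)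

/-- **(R4-low) SUFFICES AT THE DOOR'S PROFILES**: for `𝔠.p₀ + 𝔠.r₀ ≤ p₁`, `K1aLegRowsDisplayChiAtLow L 𝔠 a₀ a₁ a p₁ → K1aLegRowsDisplayChiAt L 𝔠 a₀ a₁ a p₁`
(`cfgDistOwnΦ_chi_of_low_of_newLevelIsBirth`, constant `max C_s (cB·(√L)⁻¹(1+log √L)^{p₁})`). [cite: Balaban1985UV3, (27)-(28) p.263, (44) p.267] -/
theorem k1aLegRowsDisplayChiAt_of_low {L : ℕ} {𝔠 : AlphaConsts L (suGroupModel 2).N} {a₀ a₁ a p₁ : ℝ} (hp : 𝔠.p₀ + 𝔠.r₀ ≤ p₁)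
    (h : K1aLegRowsDisplayChiAtLow L 𝔠 a₀ a₁ a p₁) : K1aLegRowsDisplayChiAt L 𝔠 a₀ a₁ a p₁ := by
  obtain ⟨κ', ρ, C, C_A, C_s, C_B, γB, hκ', hρ, hC, hCA, hCs, hCB, hγB, hall⟩ := h
  refine ⟨κ', ρ, C, C_A, max C_s (𝔠.cB * ((Real.sqrt L)⁻¹ * (1 + Real.log (Real.sqrt L)) ^ p₁)), C_B, γB, hκ', hρ, hC, hCA, le_max_of_le_left hCs, hCB, hγB,
    fun F γ hF hγ hγle hγ1 => ?_⟩
  obtain ⟨Ψ, BR, hΨ, hBR, himp⟩ := hall F γ hF hγ hγle hγ1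
  refine ⟨Ψ, BR, hΨ, hBR, fun hOf => ?_⟩
  obtain ⟨p, hp', Φ, e, B, hK, hA, hN, hM1, hS, hBC⟩ := himp hOf
  subst hF
  exact ⟨p, hp', Φ, e, B, hK, hA, hN, hM1, cfgDistOwnΦ_chi_of_low_of_newLevelIsBirth p hp hCs hN hS, hBC⟩

end Summit.QuantumFields.YangMills.Theorems.GlobalSlackKernelLeg

namespace Summit.QuantumFields.YangMills.Theorems.InteriorExcision

open Literature.MathematicalPhysics.QuantumFieldTheory.Balaban1983to89.T3UnitLawDensityEML (ℰp)
open Literature.MathematicalPhysics.QuantumFieldTheory.Balaban1983to89.T3InteriorExcision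
open Literature.MathematicalPhysics.QuantumFieldTheory.Balaban1983to89.T3PrintedRegularMinimiser
open Literature.MathematicalPhysics.QuantumFieldTheory.Balaban1983to89.T3PrintedMinimiserExistence
open Literature.MathematicalPhysics.QuantumFieldTheory.Balaban1983to89.T3SmallLiftHistory
open Literature.MathematicalPhysics.QuantumFieldTheory.Balaban1983to89.T3LowerAlongMinimisersSplit (MinimisersIn8At)
open Literature.MathematicalPhysics.QuantumFieldTheory.Balaban1983to89.T3ConstrainedMinimiser (fibre)
open Literature.MathematicalPhysics.QuantumFieldTheory.Balaban1983to89.T3Thm1Carrier (famX Idx)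
open Summit.QuantumFields.YangMills.Theorems.GlobalSlackKernelLeg (K1aLegRowsDisplayChiAt K1aLegRowsDisplayChiAtLow k1aLegRowsDisplayChiAt_of_low)

/-- **THE DECIDING CRUX FROM T8, THE χ-RECORD AND THE DISPLAY WITH (R4) BELOW THE NEW LEVEL ONLY, EVERY ODD BLOCK SIZE**
(`regPrIntL_of_T8_recChi_k1aLegRowsDisplayChiAt_allL ∘ k1aLegRowsDisplayChiAt_of_low`). [cite: King1986, Thm 3.4 (3.9) p.656; Balaban1985UV3, (27)-(28) p.263, (41) p.266, (43)-(47) pp.266-267, (57) p.270, Thm 2 p.272; Balaban1985Variational, Thm 1 (8) p.279] -/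
theorem regPrIntL_of_T8_recChi_k1aLegRowsDisplayChiAtLow_allL
    (hT8 : ∀ L : ℕ, Odd L → 1 < L → ∃ a₀ a₁ B₃ : ℝ, 0 < a₀ ∧ 0 < a₁ ∧ 0 < B₃ ∧
      Thm1GlobalMinAt L a₀ a₁ B₃ ∧ MinimisersIn8At L a₀ a₁ B₃)
    (h2 : ∀ L : ℕ, Odd L → 1 < L → Summit.QuantumFields.YangMills.Theorems.AlphaInputsT3ACv3RecChi L)
    (hDisp : ∀ (L : ℕ), Odd L → 1 < L → ∀ (𝔠 : AlphaConsts L (suGroupModel 2).N) (a₀ a₁ : ℝ), 0 < a₀ → 0 < a₁ → 𝔠.B₃ * a₁ ≤ a₀ →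
      ∃ a : ℝ, 0 < a ∧ a < 1 ∧ ∃ p₁ : ℝ, 𝔠.p₀ + 𝔠.r₀ ≤ p₁ ∧ K1aLegRowsDisplayChiAtLow L 𝔠 a₀ a₁ a p₁) :
    FluctuationComparisonRegPrIntL :=
  regPrIntL_of_T8_recChi_k1aLegRowsDisplayChiAt_allL hT8 h2 fun L hLo hL 𝔠 a₀ a₁ ha0 ha1 hw => by
    obtain ⟨a, ha, ha1, p₁, hp₁, hD⟩ := hDisp L hLo hL 𝔠 a₀ a₁ ha0 ha1 hw
    exact ⟨a, ha, ha1, p₁, hp₁, k1aLegRowsDisplayChiAt_of_low hp₁ hD⟩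

/-- **THE DECIDING CRUX FROM 19200's TWO v10 LEAVES, THE χ-RECORD AND THE SIX-ROW DISPLAY AT `p₁ ≥ p₀ + r₀`** (OWNER RULING g24-№5, DEPMAP v3.6 «20520 ⇐ {H, EX, 2′χ, one K1a
predicate}»): the texts of `stub_halvingStep` (H) and `stub_existenceMinimalOrbit` (EX) VERBATIM, 2′χ, and the display `K1aLegRowsDisplayChiAt` at a supplier-chosen profile give
`FluctuationComparisonRegPrIntL` — T8 by ★w4-20520 g0's `AttainmentOfExistence.thm1In8GlobalMin_of_halvingStep_of_existence`, then `regPrIntL_of_T8_recChi_k1aLegRowsDisplayChiAt_allL`.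
[cite: Balaban1985Variational, Thm 1 (8) p.279, Prop. 7 p.299, Prop. 8 p.304; Balaban1985UV3, (41) p.266, (43)-(47) pp.266-267, (57) p.270, (61)-(63) pp.271-272, Thm 2 p.272; King1986, Thm 3.4 (3.9) p.656, Prop. 3.6 (3.56) p.662] -/
theorem regPrIntL_of_halving_exist_recChi_k1aLegRowsDisplayChiAt_allL
    (hV2 : ∀ (L : ℕ), 1 < L → ∃ B₃ : ℝ, 4 < B₃ ∧ ∃ a₅ : ℝ, 0 < a₅ ∧
      ∀ (i : Idx L) (ε₀ ε₁ : ℝ), 0 < ε₁ → ∀ (V : (famX L i).Bdry) (U : (famX L i).Cfg), (famX L i).Reg7 ε₁ V → (famX L i).InU ε₀ U →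
        (famX L i).InB V U → (famX L i).IsCritical V U → ε₀ ≤ a₅ → (famX L i).InU (max (B₃ * ε₁) (ε₀ / 2)) U)
    (hEX : ∀ (L : ℕ), 1 < L → ∀ (B₃ : ℝ), 4 < B₃ → ∃ a₁' O₁ : ℝ, 0 < a₁' ∧ 1 ≤ O₁ ∧
      ∀ (F : T3Family), F.L = L → ∀ (n K : ℕ) (hnK : n < K) (ε₁ : ℝ), 0 < ε₁ →
        ∀ V : GaugeField (F.P n) 0 (Matrix.specialUnitaryGroup (Fin 2) ℂ), PlaqSmall ε₁ V →
          ∀ U₀ : GaugeField (F.P K) 0 (Matrix.specialUnitaryGroup (Fin 2) ℂ), RegPr F n K ((L : ℝ) ^ 3 * B₃ * ε₁) U₀ → U₀ ∈ fibre F ℰp n K hnK.le V →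
            ε₁ ≤ a₁' → ∃ U ∈ regFibrePr F n K hnK.le (O₁ * (L : ℝ) ^ 3 * B₃ * ε₁) V,
              IsMinOn (fun W : GaugeField (F.P K) 0 (Matrix.specialUnitaryGroup (Fin 2) ℂ) => wilsonAction4 W)
                (regFibrePr F n K hnK.le (O₁ * (L : ℝ) ^ 3 * B₃ * ε₁) V) U)
    (h2 : ∀ L : ℕ, Odd L → 1 < L → Summit.QuantumFields.YangMills.Theorems.AlphaInputsT3ACv3RecChi L)
    (hDisp : ∀ (L : ℕ), Odd L → 1 < L → ∀ (𝔠 : AlphaConsts L (suGroupModel 2).N) (a₀ a₁ : ℝ), 0 < a₀ → 0 < a₁ → 𝔠.B₃ * a₁ ≤ a₀ →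
      ∃ a : ℝ, 0 < a ∧ a < 1 ∧ ∃ p₁ : ℝ, 𝔠.p₀ + 𝔠.r₀ ≤ p₁ ∧ K1aLegRowsDisplayChiAt L 𝔠 a₀ a₁ a p₁) :
    FluctuationComparisonRegPrIntL :=
  regPrIntL_of_T8_recChi_k1aLegRowsDisplayChiAt_allL (AttainmentOfExistence.thm1In8GlobalMin_of_halvingStep_of_existence hV2 hEX) h2 hDisp

/-- **THE SAME WITH (R4) ASKED BELOW THE NEW LEVEL ONLY** (`… ∘ k1aLegRowsDisplayChiAt_of_low`): 20520 ⇐ {H, EX, 2′χ, the display `K1aLegRowsDisplayChiAtLow` at some `p₁ ≥ p₀ + r₀`}.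
[cite: Balaban1985Variational, Thm 1 (8) p.279, Prop. 8 p.304; Balaban1985UV3, (27)-(28) p.263, (41) p.266, (43)-(47) pp.266-267, Thm 2 p.272; King1986, Thm 3.4 (3.9) p.656] -/
theorem regPrIntL_of_halving_exist_recChi_k1aLegRowsDisplayChiAtLow_allL
    (hV2 : ∀ (L : ℕ), 1 < L → ∃ B₃ : ℝ, 4 < B₃ ∧ ∃ a₅ : ℝ, 0 < a₅ ∧
      ∀ (i : Idx L) (ε₀ ε₁ : ℝ), 0 < ε₁ → ∀ (V : (famX L i).Bdry) (U : (famX L i).Cfg), (famX L i).Reg7 ε₁ V → (famX L i).InU ε₀ U →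
        (famX L i).InB V U → (famX L i).IsCritical V U → ε₀ ≤ a₅ → (famX L i).InU (max (B₃ * ε₁) (ε₀ / 2)) U)
    (hEX : ∀ (L : ℕ), 1 < L → ∀ (B₃ : ℝ), 4 < B₃ → ∃ a₁' O₁ : ℝ, 0 < a₁' ∧ 1 ≤ O₁ ∧
      ∀ (F : T3Family), F.L = L → ∀ (n K : ℕ) (hnK : n < K) (ε₁ : ℝ), 0 < ε₁ →
        ∀ V : GaugeField (F.P n) 0 (Matrix.specialUnitaryGroup (Fin 2) ℂ), PlaqSmall ε₁ V →
          ∀ U₀ : GaugeField (F.P K) 0 (Matrix.specialUnitaryGroup (Fin 2) ℂ), RegPr F n K ((L : ℝ) ^ 3 * B₃ * ε₁) U₀ → U₀ ∈ fibre F ℰp n K hnK.le V →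
            ε₁ ≤ a₁' → ∃ U ∈ regFibrePr F n K hnK.le (O₁ * (L : ℝ) ^ 3 * B₃ * ε₁) V,
              IsMinOn (fun W : GaugeField (F.P K) 0 (Matrix.specialUnitaryGroup (Fin 2) ℂ) => wilsonAction4 W)
                (regFibrePr F n K hnK.le (O₁ * (L : ℝ) ^ 3 * B₃ * ε₁) V) U)
    (h2 : ∀ L : ℕ, Odd L → 1 < L → Summit.QuantumFields.YangMills.Theorems.AlphaInputsT3ACv3RecChi L)
    (hDisp : ∀ (L : ℕ), Odd L → 1 < L → ∀ (𝔠 : AlphaConsts L (suGroupModel 2).N) (a₀ a₁ : ℝ), 0 < a₀ → 0 < a₁ → 𝔠.B₃ * a₁ ≤ a₀ →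
      ∃ a : ℝ, 0 < a ∧ a < 1 ∧ ∃ p₁ : ℝ, 𝔠.p₀ + 𝔠.r₀ ≤ p₁ ∧ K1aLegRowsDisplayChiAtLow L 𝔠 a₀ a₁ a p₁) :
    FluctuationComparisonRegPrIntL :=
  regPrIntL_of_T8_recChi_k1aLegRowsDisplayChiAtLow_allL (AttainmentOfExistence.thm1In8GlobalMin_of_halvingStep_of_existence hV2 hEX) h2 hDisp

end Summit.QuantumFields.YangMills.Theorems.InteriorExcision

end
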